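import Summits.CriticalPhenomena.PercolationContinuityZ3.Theorems.PercNearOneGluingNoHeavyLowerTailSahiE4UnionThreeCoinT3
import Summits.CriticalPhenomena.PercolationContinuityZ3.Theorems.PercNearOneGluingNoHeavyLowerTailSahiE4UnionAAdmOfH4Plus
import Summits.CriticalPhenomena.PercolationContinuityZ3.Theorems.PercNearOneGluingNoHeavyLowerTailSahiE4UnionHoldMoments
import Summits.CriticalPhenomena.PercolationContinuityZ3.Theorems.PercNearOneGluingNoHeavyLowerTailSahiE4UnionTensorMoments
import Mathlib.Tactic.LinearCombination
import HarnessLib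

/-!
# `NoHeavyLowerTail` (crux stmt-CriticalPhenomena-4575), Sahi programme P4 — the three-coin block `b = (c₁c₂, c₁c₃, c₂c₃, c₁c₂c₃)` at MEASURE level (part B)

Support file (cell `prim-l12`, seat P4, generation 39; `--supports stmt-CriticalPhenomena-4575`).  No definitions, no named facts, no sorries;
standard axioms.  `(γ,μ)`: finite preorder with a positively associated probability weight, `a : Fin 4 → γ → [0,1]` monotone with `H4Plus μ a`;
`(β,ν)`: ANY finite probability space with three `{0,1}`-valued events `c₁, c₂, c₃` that are (mutually) independent under `ν`; block `b = (c₁c₂, c₁c₃, c₂c₃, c₁c₂c₃)`;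
`u_i = a_i ∨ b_i` on `γ × β` with the product weight.  THEOREMS: `E₄^{μ⊗ν}(u) ≥ 0` and the order-3 product rows, from the hold-moment theorems of
`…ThreeCoinT3` (multivariate Bernstein split) via `SahiE4UnionHold.uMoment_S` / `exFail_S` and the block moments in `E c₁, E c₂, E c₃`.
HONEST FRAMING: one specific four-member block; the general four-member step is open. [this work]
-/

noncomputable section

namespace Summit.CriticalPhenomena.PercolationContinuityZ3.Theorems.SahiE4UnionThreeCoin

open Finset Function Literature.Combinatorics.Sahi2008
open Summit.CriticalPhenomena.PercolationContinuityZ3.Theorems.SahiE3UnionTensor (ex_add' ex_sub' sum_prodWeight ex_tensor)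
open Summit.CriticalPhenomena.PercolationContinuityZ3.Theorems.SahiE4UnionTensor (sahiE_four_apply)
open Summit.CriticalPhenomena.PercolationContinuityZ3.Theorems.SahiE4UnionHold
open Summit.CriticalPhenomena.PercolationContinuityZ3.Theorems.SahiE4UnionThree
open Summit.CriticalPhenomena.PercolationContinuityZ3.Theorems.SahiE4UnionTwoCoin (aAdmissible_of_h4Plus)
open Summit.CriticalPhenomena.PercolationContinuityZ3.Theorems.SahiH4Plus

variable {γ β : Type*} [Fintype γ] [Fintype β] [Preorder γ]

set_option maxHeartbeats 1600000 in
set_option maxRecDepth 8000 in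
/-- `e3prod02_orThreeCoinT3_nonneg` with the fifteen hold moments as named reals. [this work] -/
theorem e3prod02_orThreeCoinT3_nonneg_explicit (t0 t1 t2 t3 t01 t02 t03 t12 t13 t23 t012 t013 t023 t123 t0123 θ₁ θ₂ θ₃ : ℝ)
    (hT : AAdmissible ![t0, t1, t2, t3, t01, t02, t03, t12, t13, t23, t012, t013, t023, t123, t0123]) (h10 : 0 ≤ θ₁) (h11 : θ₁ ≤ 1) (h20 : 0 ≤ θ₂) (h21 : θ₂ ≤ 1) (h30 : 0 ≤ θ₃) (h31 : θ₃ ≤ 1) :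
    0 ≤ 2 * t0123 - t1 * t023 - t3 * t012 - t02 * t13 + t1 * t3 * t02 + 2 * t013 * θ₂ * θ₃ + t023 * θ₁ * θ₃ + 2 * t123 * θ₁ * θ₂ - 2 * t0123 * θ₁ * θ₂ - 2 * t0123 * θ₁ * θ₃ - 2 * t0123 * θ₂ * θ₃ + 2 * θ₁ * θ₂ * θ₃ - t0 * t13 * θ₂ * θ₃ - t1 * t03 * θ₂ * θ₃ - t1 * t23 * θ₁ * θ₂ + t1 * t023 * θ₁ * θ₂ + t1 * t023 * θ₁ * θ₃ + t1 * t023 * θ₂ * θ₃ - t1 * θ₁ * θ₂ * θ₃ - t2 * t13 * θ₁ * θ₂ - t3 * t01 * θ₂ * θ₃ - t3 * t02 * θ₁ * θ₃ - t3 * t12 * θ₁ * θ₂ + t3 * t012 * θ₁ * θ₂ + t3 * t012 * θ₁ * θ₃ + t3 * t012 * θ₂ * θ₃ - t3 * θ₁ * θ₂ * θ₃ + t02 * t13 * θ₁ * θ₂ + t02 * t13 * θ₁ * θ₃ + t02 * t13 * θ₂ * θ₃ - t02 * θ₁ * θ₂ * θ₃ - t13 * θ₁ * θ₂ * θ₃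 - t012 * θ₁ * θ₂ * θ₃ - 2 * t013 * θ₁ * θ₂ * θ₃ - 2 * t023 * θ₁ * θ₂ * θ₃ - 2 * t123 * θ₁ * θ₂ * θ₃ + 4 * t0123 * θ₁ * θ₂ * θ₃ + t0 * t1 * t3 * θ₂ * θ₃ + t0 * t13 * θ₁ * θ₂ * θ₃ + t1 * t2 * t3 * θ₁ * θ₂ - t1 * t3 * t02 * θ₁ * θ₂ - t1 * t3 * t02 * θ₁ * θ₃ - t1 * t3 * t02 * θ₂ * θ₃ + t1 * t3 * θ₁ * θ₂ * θ₃ + t1 * t02 * θ₁ * θ₂ * θ₃ + t1 * t03 * θ₁ * θ₂ * θ₃ + t1 * t23 * θ₁ * θ₂ * θ₃ - t1 * t023 * θ₁ * θ₂ * θ₃ + t2 * t13 * θ₁ * θ₂ * θ₃ + t3 * t01 * θ₁ * θ₂ * θ₃ + 2 * t3 * t02 * θ₁ * θ₂ * θ₃ + t3 * t12 * θ₁ * θ₂ * θ₃ - t3 * t012 * θ₁ * θ₂ * θ₃ - t02 * t13 * θ₁ * θ₂ * θ₃ - t03 * θ₁ * θ₂ * θ₃ * θ₃ - t23 * θ₁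 * θ₁ * θ₂ * θ₃ + t023 * θ₁ * θ₂ * θ₃ * θ₃ + t023 * θ₁ * θ₁ * θ₂ * θ₃ - θ₁ * θ₁ * θ₂ * θ₃ * θ₃ - t0 * t1 * t3 * θ₁ * θ₂ * θ₃ + t0 * t13 * θ₁ * θ₂ * θ₃ * θ₃ - t0 * θ₁ * θ₂ * θ₂ * θ₃ * θ₃ - t1 * t2 * t3 * θ₁ * θ₂ * θ₃ + t1 * t03 * θ₁ * θ₂ * θ₃ * θ₃ + t1 * t23 * θ₁ * θ₁ * θ₂ * θ₃ - t1 * t023 * θ₁ * θ₂ * θ₃ * θ₃ - t1 * t023 * θ₁ * θ₁ * θ₂ * θ₃ + t1 * θ₁ * θ₁ * θ₂ * θ₃ * θ₃ + t2 * t13 * θ₁ * θ₁ * θ₂ * θ₃ - t2 * θ₁ * θ₁ * θ₂ * θ₂ * θ₃ - t01 * θ₁ * θ₂ * θ₂ * θ₃ * θ₃ - t02 * t13 * θ₁ * θ₂ * θ₃ * θ₃ - t02 * t13 * θ₁ * θ₁ * θ₂ * θ₃ + t02 * θ₁ * θ₂ * θ₂ * θ₃ * θ₃ + t02 * θ₁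 * θ₁ * θ₂ * θ₂ * θ₃ + t03 * θ₁ * θ₁ * θ₂ * θ₃ * θ₃ - t12 * θ₁ * θ₁ * θ₂ * θ₂ * θ₃ + t13 * θ₁ * θ₁ * θ₂ * θ₃ * θ₃ + t23 * θ₁ * θ₁ * θ₂ * θ₃ * θ₃ + t012 * θ₁ * θ₂ * θ₂ * θ₃ * θ₃ + t012 * θ₁ * θ₁ * θ₂ * θ₃ * θ₃ + t012 * θ₁ * θ₁ * θ₂ * θ₂ * θ₃ - t023 * θ₁ * θ₁ * θ₂ * θ₃ * θ₃ - 2 * θ₁ * θ₁ * θ₂ * θ₂ * θ₃ * θ₃ - t0 * t1 * t3 * θ₁ * θ₂ * θ₃ * θ₃ + t0 * t1 * θ₁ * θ₂ * θ₂ * θ₃ * θ₃ + t0 * t3 * θ₁ * θ₂ * θ₂ * θ₃ * θ₃ - t0 * t13 * θ₁ * θ₁ * θ₂ * θ₃ * θ₃ + t0 * θ₁ * θ₁ * θ₂ * θ₂ * θ₃ * θ₃ - t1 * t2 * t3 * θ₁ * θ₁ * θ₂ * θ₃ + t1 * t2 * θ₁ * θ₁ * θ₂ * θ₂ * θ₃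 + t1 * t3 * t02 * θ₁ * θ₂ * θ₃ * θ₃ + t1 * t3 * t02 * θ₁ * θ₁ * θ₂ * θ₃ - t1 * t3 * θ₁ * θ₁ * θ₂ * θ₃ * θ₃ - t1 * t02 * θ₁ * θ₂ * θ₂ * θ₃ * θ₃ - t1 * t02 * θ₁ * θ₁ * θ₂ * θ₃ * θ₃ - t1 * t02 * θ₁ * θ₁ * θ₂ * θ₂ * θ₃ - t1 * t03 * θ₁ * θ₁ * θ₂ * θ₃ * θ₃ - t1 * t23 * θ₁ * θ₁ * θ₂ * θ₃ * θ₃ + t1 * t023 * θ₁ * θ₁ * θ₂ * θ₃ * θ₃ + t1 * θ₁ * θ₁ * θ₂ * θ₂ * θ₃ * θ₃ + t2 * t3 * θ₁ * θ₁ * θ₂ * θ₂ * θ₃ - t2 * t13 * θ₁ * θ₁ * θ₂ * θ₃ * θ₃ + t2 * θ₁ * θ₁ * θ₂ * θ₂ * θ₃ * θ₃ + t3 * t01 * θ₁ * θ₂ * θ₂ * θ₃ * θ₃ - t3 * t02 * θ₁ * θ₂ * θ₂ * θ₃ * θ₃ - t3 * t02 * θ₁ * θ₁ * θ₂ * θ₂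 * θ₃ + t3 * t12 * θ₁ * θ₁ * θ₂ * θ₂ * θ₃ - t3 * t012 * θ₁ * θ₂ * θ₂ * θ₃ * θ₃ - t3 * t012 * θ₁ * θ₁ * θ₂ * θ₃ * θ₃ - t3 * t012 * θ₁ * θ₁ * θ₂ * θ₂ * θ₃ + 2 * t3 * θ₁ * θ₁ * θ₂ * θ₂ * θ₃ * θ₃ + t01 * θ₁ * θ₁ * θ₂ * θ₂ * θ₃ * θ₃ + t02 * t13 * θ₁ * θ₁ * θ₂ * θ₃ * θ₃ + t12 * θ₁ * θ₁ * θ₂ * θ₂ * θ₃ * θ₃ - 2 * t012 * θ₁ * θ₁ * θ₂ * θ₂ * θ₃ * θ₃ - t0 * t1 * t3 * θ₁ * θ₂ * θ₂ * θ₃ * θ₃ + t0 * t1 * t3 * θ₁ * θ₁ * θ₂ * θ₃ * θ₃ - t0 * t1 * θ₁ * θ₁ * θ₂ * θ₂ * θ₃ * θ₃ - t0 * t3 * θ₁ * θ₁ * θ₂ * θ₂ * θ₃ * θ₃ + t0 * θ₁ * θ₁ * θ₂ * θ₂ * θ₃ * θ₃ * θ₃ + t1 * t2 * t3 * θ₁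 * θ₁ * θ₂ * θ₃ * θ₃ - t1 * t2 * t3 * θ₁ * θ₁ * θ₂ * θ₂ * θ₃ - t1 * t2 * θ₁ * θ₁ * θ₂ * θ₂ * θ₃ * θ₃ + t1 * t3 * t02 * θ₁ * θ₂ * θ₂ * θ₃ * θ₃ + t1 * t3 * t02 * θ₁ * θ₁ * θ₂ * θ₂ * θ₃ - t1 * t3 * θ₁ * θ₁ * θ₂ * θ₂ * θ₃ * θ₃ + t1 * t02 * θ₁ * θ₁ * θ₂ * θ₂ * θ₃ * θ₃ - t2 * t3 * θ₁ * θ₁ * θ₂ * θ₂ * θ₃ * θ₃ + t2 * θ₁ * θ₁ * θ₁ * θ₂ * θ₂ * θ₃ * θ₃ - t3 * t01 * θ₁ * θ₁ * θ₂ * θ₂ * θ₃ * θ₃ - t3 * t12 * θ₁ * θ₁ * θ₂ * θ₂ * θ₃ * θ₃ + 2 * t3 * t012 * θ₁ * θ₁ * θ₂ * θ₂ * θ₃ * θ₃ - t02 * θ₁ * θ₁ * θ₂ * θ₂ * θ₃ * θ₃ * θ₃ - t02 * θ₁ * θ₁ * θ₁ * θ₂ * θ₂ * θ₃ * θ₃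 + θ₁ * θ₁ * θ₁ * θ₂ * θ₂ * θ₃ * θ₃ * θ₃ + t0 * t1 * t3 * θ₁ * θ₁ * θ₂ * θ₂ * θ₃ * θ₃ - t0 * t1 * θ₁ * θ₁ * θ₂ * θ₂ * θ₃ * θ₃ * θ₃ - t0 * t3 * θ₁ * θ₁ * θ₂ * θ₂ * θ₃ * θ₃ * θ₃ - t0 * θ₁ * θ₁ * θ₁ * θ₂ * θ₂ * θ₃ * θ₃ * θ₃ + t1 * t2 * t3 * θ₁ * θ₁ * θ₂ * θ₂ * θ₃ * θ₃ - t1 * t2 * θ₁ * θ₁ * θ₁ * θ₂ * θ₂ * θ₃ * θ₃ - t1 * t3 * t02 * θ₁ * θ₁ * θ₂ * θ₂ * θ₃ * θ₃ + t1 * t02 * θ₁ * θ₁ * θ₂ * θ₂ * θ₃ * θ₃ * θ₃ + t1 * t02 * θ₁ * θ₁ * θ₁ * θ₂ * θ₂ * θ₃ * θ₃ - t1 * θ₁ * θ₁ * θ₁ * θ₂ * θ₂ * θ₃ * θ₃ * θ₃ - t2 * t3 * θ₁ * θ₁ * θ₁ * θ₂ * θ₂ * θ₃ * θ₃ - t2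 * θ₁ * θ₁ * θ₁ * θ₂ * θ₂ * θ₃ * θ₃ * θ₃ + t3 * t02 * θ₁ * θ₁ * θ₂ * θ₂ * θ₃ * θ₃ * θ₃ + t3 * t02 * θ₁ * θ₁ * θ₁ * θ₂ * θ₂ * θ₃ * θ₃ - t3 * θ₁ * θ₁ * θ₁ * θ₂ * θ₂ * θ₃ * θ₃ * θ₃ + t02 * θ₁ * θ₁ * θ₁ * θ₂ * θ₂ * θ₃ * θ₃ * θ₃ + t0 * t1 * t3 * θ₁ * θ₁ * θ₂ * θ₂ * θ₃ * θ₃ * θ₃ + t0 * t1 * θ₁ * θ₁ * θ₁ * θ₂ * θ₂ * θ₃ * θ₃ * θ₃ + t0 * t3 * θ₁ * θ₁ * θ₁ * θ₂ * θ₂ * θ₃ * θ₃ * θ₃ + t1 * t2 * t3 * θ₁ * θ₁ * θ₁ * θ₂ * θ₂ * θ₃ * θ₃ + t1 * t2 * θ₁ * θ₁ * θ₁ * θ₂ * θ₂ * θ₃ * θ₃ * θ₃ - t1 * t3 * t02 * θ₁ * θ₁ * θ₂ * θ₂ * θ₃ * θ₃ * θ₃ - t1 * t3 * t02 * θ₁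 * θ₁ * θ₁ * θ₂ * θ₂ * θ₃ * θ₃ + t1 * t3 * θ₁ * θ₁ * θ₁ * θ₂ * θ₂ * θ₃ * θ₃ * θ₃ - t1 * t02 * θ₁ * θ₁ * θ₁ * θ₂ * θ₂ * θ₃ * θ₃ * θ₃ + t2 * t3 * θ₁ * θ₁ * θ₁ * θ₂ * θ₂ * θ₃ * θ₃ * θ₃ - t3 * t02 * θ₁ * θ₁ * θ₁ * θ₂ * θ₂ * θ₃ * θ₃ * θ₃ - t0 * t1 * t3 * θ₁ * θ₁ * θ₁ * θ₂ * θ₂ * θ₃ * θ₃ * θ₃ - t1 * t2 * t3 * θ₁ * θ₁ * θ₁ * θ₂ * θ₂ * θ₃ * θ₃ * θ₃ + t1 * t3 * t02 * θ₁ * θ₁ * θ₁ * θ₂ * θ₂ * θ₃ * θ₃ * θ₃ := by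
  have h := e3prod02_orThreeCoinT3_nonneg _ θ₁ θ₂ θ₃ hT h10 h11 h20 h21 h30 h31
  exact h

set_option maxHeartbeats 4000000 in
set_option maxRecDepth 100000 in
/-- **`E₃(u_0u_2, u_1, u_3) ≥ 0` for the OR with the independent three-coin block `b = (c₁c₂, c₁c₃, c₂c₃, c₁c₂c₃)`** (measure level). [this work] -/
theorem sahiE_three_prodRow02_orThreeCoinT3_nonneg (μ : γ → ℝ) (ν : β → ℝ)
    (hμ0 : ∀ t, 0 ≤ μ t) (hμ1 : ∑ t, μ t = 1) (hν0 : ∀ t, 0 ≤ ν t) (hν1 : ∑ t, ν t = 1) (hμ2 : SahiPositive μ 2)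
    (a : Fin 4 → γ → ℝ) (b : Fin 4 → β → ℝ) (ha0 : ∀ i t, 0 ≤ a i t) (ha1 : ∀ i t, a i t ≤ 1) (ham : ∀ i, Monotone (a i))
    (c₁ c₂ c₃ : β → ℝ) (hc₁ : ∀ y, c₁ y = 0 ∨ c₁ y = 1) (hc₂ : ∀ y, c₂ y = 0 ∨ c₂ y = 1) (hc₃ : ∀ y, c₃ y = 0 ∨ c₃ y = 1)
    (h12 : ex ν (c₁ * c₂) = ex ν c₁ * ex ν c₂) (h13 : ex ν (c₁ * c₃) = ex ν c₁ * ex ν c₃) (h23 : ex ν (c₂ * c₃) = ex ν c₂ * ex ν c₃)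
    (h123 : ex ν (c₁ * c₂ * c₃) = ex ν c₁ * ex ν c₂ * ex ν c₃)
    (hb0 : b 0 = c₁ * c₂) (hb1 : b 1 = c₁ * c₃) (hb2 : b 2 = c₂ * c₃) (hb3 : b 3 = c₁ * c₂ * c₃) (h : H4Plus μ a) :
    0 ≤ sahiE (fun p : γ × β => μ p.1 * ν p.2) 3 ![(fun (i : Fin 4) (p : γ × β) => a i p.1 + b i p.2 - a i p.1 * b i p.2) 0 * (fun (i : Fin 4) (p : γ × β) => a i p.1 + b i p.2 - a i p.1 * b i p.2) 2, (fun (i : Fin 4) (p : γ × β) => a i p.1 + b i p.2 - a i p.1 * b i p.2) 1, (fun (i : Fin 4) (p : γ × β) => a i p.1 + b i p.2 - a i p.1 * b i p.2) 3] := by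
  have hT := aAdmissible_of_h4Plus μ hμ0 hμ1 hμ2 a ha0 ha1 ham h
  have h10 : 0 ≤ ex ν c₁ := ex_nonneg hν0 (fun y => by rcases hc₁ y with e | e <;> simp [e])
  have h11 : ex ν c₁ ≤ 1 := by
    have t := ex_mono hν0 (fun y => show c₁ y ≤ (fun _ => (1:ℝ)) y by rcases hc₁ y with e | e <;> simp [e]); rw [ex_const hν1] at t; exact t
  have h20 : 0 ≤ ex ν c₂ := ex_nonneg hν0 (fun y => by rcases hc₂ y with e | e <;> simp [e])
  have h21 : ex ν c₂ ≤ 1 := by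
    have t := ex_mono hν0 (fun y => show c₂ y ≤ (fun _ => (1:ℝ)) y by rcases hc₂ y with e | e <;> simp [e]); rw [ex_const hν1] at t; exact t
  have h30 : 0 ≤ ex ν c₃ := ex_nonneg hν0 (fun y => by rcases hc₃ y with e | e <;> simp [e])
  have h31 : ex ν c₃ ≤ 1 := by
    have t := ex_mono hν0 (fun y => show c₃ y ≤ (fun _ => (1:ℝ)) y by rcases hc₃ y with e | e <;> simp [e]); rw [ex_const hν1] at t; exact t
  have mb0 : ex ν (b 0) = ex ν c₁ * ex ν c₂ := by
    have e : (b 0 : β → ℝ) = c₁ * c₂ := by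
      funext y; rcases hc₁ y with h1 | h1 <;> rcases hc₂ y with h2 | h2 <;> simp [hb0, h1, h2]
    rw [e, h12]
  have mb1 : ex ν (b 1) = ex ν c₁ * ex ν c₃ := by
    have e : (b 1 : β → ℝ) = c₁ * c₃ := by
      funext y; rcases hc₁ y with h1 | h1 <;> rcases hc₃ y with h3 | h3 <;> simp [hb1, h1, h3]
    rw [e, h13]
  have mb2 : ex ν (b 2) = ex ν c₂ * ex ν c₃ := by
    have e : (b 2 : β → ℝ) = c₂ * c₃ := by
      funext y; rcases hc₂ y with h2 | h2 <;> rcases hc₃ y with h3 | h3 <;> simp [hb2, h2, h3]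
    rw [e, h23]
  have mb3 : ex ν (b 3) = ex ν c₁ * ex ν c₂ * ex ν c₃ := by
    have e : (b 3 : β → ℝ) = c₁ * c₂ * c₃ := by
      funext y; rcases hc₁ y with h1 | h1 <;> rcases hc₂ y with h2 | h2 <;> rcases hc₃ y with h3 | h3 <;> simp [hb3, h1, h2, h3]
    rw [e, h123]
  have mb01 : ex ν (b 0 * b 1) = ex ν c₁ * ex ν c₂ * ex ν c₃ := by
    have e : (b 0 * b 1 : β → ℝ) = c₁ * c₂ * c₃ := by
      funext y; rcases hc₁ y with h1 | h1 <;> rcases hc₂ y with h2 | h2 <;> rcases hc₃ y with h3 | h3 <;> simp [hb0, hb1, h1, h2, h3]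
    rw [e, h123]
  have mb02 : ex ν (b 0 * b 2) = ex ν c₁ * ex ν c₂ * ex ν c₃ := by
    have e : (b 0 * b 2 : β → ℝ) = c₁ * c₂ * c₃ := by
      funext y; rcases hc₁ y with h1 | h1 <;> rcases hc₂ y with h2 | h2 <;> rcases hc₃ y with h3 | h3 <;> simp [hb0, hb2, h1, h2, h3]
    rw [e, h123]
  have mb03 : ex ν (b 0 * b 3) = ex ν c₁ * ex ν c₂ * ex ν c₃ := by
    have e : (b 0 * b 3 : β → ℝ) = c₁ * c₂ * c₃ := by
      funext y; rcases hc₁ y with h1 | h1 <;> rcases hc₂ y with h2 | h2 <;> rcases hc₃ y with h3 | h3 <;> simp [hb0, hb3, h1, h2, h3]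
    rw [e, h123]
  have mb12 : ex ν (b 1 * b 2) = ex ν c₁ * ex ν c₂ * ex ν c₃ := by
    have e : (b 1 * b 2 : β → ℝ) = c₁ * c₂ * c₃ := by
      funext y; rcases hc₁ y with h1 | h1 <;> rcases hc₂ y with h2 | h2 <;> rcases hc₃ y with h3 | h3 <;> simp [hb1, hb2, h1, h2, h3]
    rw [e, h123]
  have mb13 : ex ν (b 1 * b 3) = ex ν c₁ * ex ν c₂ * ex ν c₃ := by
    have e : (b 1 * b 3 : β → ℝ) = c₁ * c₂ * c₃ := by
      funext y; rcases hc₁ y with h1 | h1 <;> rcases hc₂ y with h2 | h2 <;> rcases hc₃ y with h3 | h3 <;> simp [hb1, hb3, h1, h2, h3]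
    rw [e, h123]
  have mb23 : ex ν (b 2 * b 3) = ex ν c₁ * ex ν c₂ * ex ν c₃ := by
    have e : (b 2 * b 3 : β → ℝ) = c₁ * c₂ * c₃ := by
      funext y; rcases hc₁ y with h1 | h1 <;> rcases hc₂ y with h2 | h2 <;> rcases hc₃ y with h3 | h3 <;> simp [hb2, hb3, h1, h2, h3]
    rw [e, h123]
  have mb012 : ex ν (b 0 * b 1 * b 2) = ex ν c₁ * ex ν c₂ * ex ν c₃ := by
    have e : (b 0 * b 1 * b 2 : β → ℝ) = c₁ * c₂ * c₃ := by
      funext y; rcases hc₁ y with h1 | h1 <;> rcases hc₂ y with h2 | h2 <;> rcases hc₃ y with h3 | h3 <;> simp [hb0, hb1, hb2, h1, h2, h3]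
    rw [e, h123]
  have mb013 : ex ν (b 0 * b 1 * b 3) = ex ν c₁ * ex ν c₂ * ex ν c₃ := by
    have e : (b 0 * b 1 * b 3 : β → ℝ) = c₁ * c₂ * c₃ := by
      funext y; rcases hc₁ y with h1 | h1 <;> rcases hc₂ y with h2 | h2 <;> rcases hc₃ y with h3 | h3 <;> simp [hb0, hb1, hb3, h1, h2, h3]
    rw [e, h123]
  have mb023 : ex ν (b 0 * b 2 * b 3) = ex ν c₁ * ex ν c₂ * ex ν c₃ := by
    have e : (b 0 * b 2 * b 3 : β → ℝ) = c₁ * c₂ * c₃ := by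
      funext y; rcases hc₁ y with h1 | h1 <;> rcases hc₂ y with h2 | h2 <;> rcases hc₃ y with h3 | h3 <;> simp [hb0, hb2, hb3, h1, h2, h3]
    rw [e, h123]
  have mb123 : ex ν (b 1 * b 2 * b 3) = ex ν c₁ * ex ν c₂ * ex ν c₃ := by
    have e : (b 1 * b 2 * b 3 : β → ℝ) = c₁ * c₂ * c₃ := by
      funext y; rcases hc₁ y with h1 | h1 <;> rcases hc₂ y with h2 | h2 <;> rcases hc₃ y with h3 | h3 <;> simp [hb1, hb2, hb3, h1, h2, h3]
    rw [e, h123]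
  have mb0123 : ex ν (b 0 * b 1 * b 2 * b 3) = ex ν c₁ * ex ν c₂ * ex ν c₃ := by
    have e : (b 0 * b 1 * b 2 * b 3 : β → ℝ) = c₁ * c₂ * c₃ := by
      funext y; rcases hc₁ y with h1 | h1 <;> rcases hc₂ y with h2 | h2 <;> rcases hc₃ y with h3 | h3 <;> simp [hb0, hb1, hb2, hb3, h1, h2, h3]
    rw [e, h123]
  have cm0 : (fun (i : Fin 4) (p : γ × β) => a i p.1 + b i p.2 - a i p.1 * b i p.2) 0 * (fun (i : Fin 4) (p : γ × β) => a i p.1 + b i p.2 - a i p.1 * b i p.2) 2 * (fun (i : Fin 4) (p : γ × β) => a i p.1 + b i p.2 - a i p.1 * b i p.2) 1 * (fun (i : Fin 4) (p : γ × β) => a i p.1 + b i p.2 - a i p.1 * b i p.2) 3 = (fun (i : Fin 4) (p : γ × β) => a i p.1 + b i p.2 - a i p.1 * b i p.2) 0 * (fun (i : Fin 4) (p : γ × β) => a i p.1 + b i p.2 - a i p.1 * b i p.2) 1 * (fun (i : Fin 4) (p : γ × β) => a i p.1 + b i p.2 - a i p.1 * b i p.2) 2 * (fun (i : Fin 4)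 (p : γ × β) => a i p.1 + b i p.2 - a i p.1 * b i p.2) 3 := by funext p; simp only [Pi.mul_apply]; ring
  have cm2 : (fun (i : Fin 4) (p : γ × β) => a i p.1 + b i p.2 - a i p.1 * b i p.2) 0 * (fun (i : Fin 4) (p : γ × β) => a i p.1 + b i p.2 - a i p.1 * b i p.2) 2 * (fun (i : Fin 4) (p : γ × β) => a i p.1 + b i p.2 - a i p.1 * b i p.2) 1 = (fun (i : Fin 4) (p : γ × β) => a i p.1 + b i p.2 - a i p.1 * b i p.2) 0 * (fun (i : Fin 4) (p : γ × β) => a i p.1 + b i p.2 - a i p.1 * b i p.2) 1 * (fun (i : Fin 4) (p : γ × β) => a i p.1 + b i p.2 - a i p.1 * b i p.2) 2 := by funext p; simp only [Pi.mul_apply]; ring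
  rw [sahiE_three, cm0, cm2, uMoment_0123 μ ν hμ1 hν1 a b, uMoment_023 μ ν hμ1 hν1 a b, uMoment_012 μ ν hμ1 hν1 a b, uMoment_13 μ ν hμ1 hν1 a b, uMoment_02 μ ν hμ1 hν1 a b, uMoment_1 μ ν hμ1 hν1 a b, uMoment_3 μ ν hμ1 hν1 a b]
  rw [exFail_0 μ hμ1 a, exFail_1 μ hμ1 a, exFail_2 μ hμ1 a, exFail_3 μ hμ1 a, exFail_01 μ hμ1 a, exFail_02 μ hμ1 a, exFail_03 μ hμ1 a, exFail_12 μ hμ1 a, exFail_13 μ hμ1 a, exFail_23 μ hμ1 a, exFail_012 μ hμ1 a, exFail_013 μ hμ1 a, exFail_023 μ hμ1 a, exFail_123 μ hμ1 a, exFail_0123 μ hμ1 a]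
  rw [exFail_0 ν hν1 b, exFail_1 ν hν1 b, exFail_2 ν hν1 b, exFail_3 ν hν1 b, exFail_01 ν hν1 b, exFail_02 ν hν1 b, exFail_03 ν hν1 b, exFail_12 ν hν1 b, exFail_13 ν hν1 b, exFail_23 ν hν1 b, exFail_012 ν hν1 b, exFail_013 ν hν1 b, exFail_023 ν hν1 b, exFail_123 ν hν1 b, exFail_0123 ν hν1 b]
  rw [mb0, mb1, mb2, mb3, mb01, mb02, mb03, mb12, mb13, mb23, mb012, mb013, mb023, mb123, mb0123]
  linear_combination e3prod02_orThreeCoinT3_nonneg_explicit (ex μ (a 0)) (ex μ (a 1)) (ex μ (a 2)) (ex μ (a 3)) (ex μ (a 0 * a 1)) (ex μ (a 0 * a 2)) (ex μ (a 0 * a 3)) (ex μ (a 1 * a 2)) (ex μ (a 1 * a 3)) (ex μ (a 2 * a 3)) (ex μ (a 0 * a 1 * a 2)) (ex μ (a 0 * a 1 * a 3)) (ex μ (a 0 * a 2 * a 3)) (ex μ (a 1 * a 2 * a 3)) (ex μ (a 0 * a 1 * a 2 * a 3)) (ex ν c₁) (ex ν c₂) (ex ν c₃) hT h10 h11 h20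 h21 h30 h31

set_option maxHeartbeats 1600000 in
set_option maxRecDepth 8000 in
/-- `e3prod03_orThreeCoinT3_nonneg` with the fifteen hold moments as named reals. [this work] -/
theorem e3prod03_orThreeCoinT3_nonneg_explicit (t0 t1 t2 t3 t01 t02 t03 t12 t13 t23 t012 t013 t023 t123 t0123 θ₁ θ₂ θ₃ : ℝ)
    (hT : AAdmissible ![t0, t1, t2, t3, t01, t02, t03, t12, t13, t23, t012, t013, t023, t123, t0123]) (h10 : 0 ≤ θ₁) (h11 : θ₁ ≤ 1) (h20 : 0 ≤ θ₂) (h21 : θ₂ ≤ 1) (h30 : 0 ≤ θ₃) (h31 : θ₃ ≤ 1) :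
    0 ≤ 2 * t0123 - t1 * t023 - t2 * t013 - t03 * t12 + t1 * t2 * t03 + t013 * θ₂ * θ₃ + t023 * θ₁ * θ₃ + 2 * t123 * θ₁ * θ₂ - 2 * t0123 * θ₁ * θ₂ - 2 * t0123 * θ₁ * θ₃ - 2 * t0123 * θ₂ * θ₃ + 2 * θ₁ * θ₂ * θ₃ - t1 * t03 * θ₂ * θ₃ - t1 * t23 * θ₁ * θ₂ + t1 * t023 * θ₁ * θ₂ + t1 * t023 * θ₁ * θ₃ + t1 * t023 * θ₂ * θ₃ - t1 * θ₁ * θ₂ * θ₃ - t2 * t03 * θ₁ * θ₃ - t2 * t13 * θ₁ * θ₂ + t2 * t013 * θ₁ * θ₂ + t2 * t013 * θ₁ * θ₃ + t2 * t013 * θ₂ * θ₃ - t2 * θ₁ * θ₂ * θ₃ - t3 * t12 * θ₁ * θ₂ + t03 * t12 * θ₁ * θ₂ + t03 * t12 * θ₁ * θ₃ + t03 * t12 * θ₂ * θ₃ - t03 * θ₁ * θ₂ * θ₃ - t12 * θ₁ * θ₂ * θ₃ - 2 * t013 * θ₁ * θ₂ * θ₃ - 2 * t023 * θ₁ * θ₂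 * θ₃ - 2 * t123 * θ₁ * θ₂ * θ₃ + 4 * t0123 * θ₁ * θ₂ * θ₃ + t1 * t2 * t3 * θ₁ * θ₂ - t1 * t2 * t03 * θ₁ * θ₂ - t1 * t2 * t03 * θ₁ * θ₃ - t1 * t2 * t03 * θ₂ * θ₃ + t1 * t2 * θ₁ * θ₂ * θ₃ + 2 * t1 * t03 * θ₁ * θ₂ * θ₃ + t1 * t23 * θ₁ * θ₂ * θ₃ - t1 * t023 * θ₁ * θ₂ * θ₃ + 2 * t2 * t03 * θ₁ * θ₂ * θ₃ + t2 * t13 * θ₁ * θ₂ * θ₃ - t2 * t013 * θ₁ * θ₂ * θ₃ + t3 * t12 * θ₁ * θ₂ * θ₃ - t03 * t12 * θ₁ * θ₂ * θ₃ - t03 * θ₁ * θ₂ * θ₃ * θ₃ - t13 * θ₁ * θ₂ * θ₂ * θ₃ - t23 * θ₁ * θ₁ * θ₂ * θ₃ + t013 * θ₁ * θ₂ * θ₃ * θ₃ + t013 * θ₁ * θ₂ * θ₂ * θ₃ + t023 * θ₁ * θ₂ * θ₃ * θ₃ + t023 * θ₁ * θ₁ * θ₂ * θ₃ - θ₁ *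 θ₂ * θ₂ * θ₃ * θ₃ - θ₁ * θ₁ * θ₂ * θ₃ * θ₃ - t1 * t2 * t3 * θ₁ * θ₂ * θ₃ + t1 * t23 * θ₁ * θ₁ * θ₂ * θ₃ - t1 * t023 * θ₁ * θ₂ * θ₃ * θ₃ - t1 * t023 * θ₁ * θ₁ * θ₂ * θ₃ + t1 * θ₁ * θ₁ * θ₂ * θ₃ * θ₃ + t2 * t13 * θ₁ * θ₂ * θ₂ * θ₃ - t2 * t013 * θ₁ * θ₂ * θ₃ * θ₃ - t2 * t013 * θ₁ * θ₂ * θ₂ * θ₃ + t2 * θ₁ * θ₂ * θ₂ * θ₃ * θ₃ + t3 * t12 * θ₁ * θ₂ * θ₂ * θ₃ + t3 * t12 * θ₁ * θ₁ * θ₂ * θ₃ - t3 * θ₁ * θ₁ * θ₂ * θ₂ * θ₃ - t03 * t12 * θ₁ * θ₂ * θ₂ * θ₃ - t03 * t12 * θ₁ * θ₁ * θ₂ * θ₃ + t03 * θ₁ * θ₂ * θ₂ * θ₃ * θ₃ + t03 * θ₁ * θ₁ * θ₂ * θ₃ * θ₃ + t03 * θ₁ * θ₁ * θ₂ * θ₂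 * θ₃ + t12 * θ₁ * θ₂ * θ₂ * θ₃ * θ₃ + t12 * θ₁ * θ₁ * θ₂ * θ₃ * θ₃ + t13 * θ₁ * θ₂ * θ₂ * θ₃ * θ₃ + t23 * θ₁ * θ₁ * θ₂ * θ₃ * θ₃ - t013 * θ₁ * θ₂ * θ₂ * θ₃ * θ₃ - t023 * θ₁ * θ₁ * θ₂ * θ₃ * θ₃ - θ₁ * θ₁ * θ₂ * θ₂ * θ₃ * θ₃ - t1 * t2 * t3 * θ₁ * θ₂ * θ₂ * θ₃ - t1 * t2 * t3 * θ₁ * θ₁ * θ₂ * θ₃ + t1 * t2 * t03 * θ₁ * θ₂ * θ₃ * θ₃ + t1 * t2 * t03 * θ₁ * θ₂ * θ₂ * θ₃ + t1 * t2 * t03 * θ₁ * θ₁ * θ₂ * θ₃ - t1 * t2 * θ₁ * θ₂ * θ₂ * θ₃ * θ₃ - t1 * t2 * θ₁ * θ₁ * θ₂ * θ₃ * θ₃ + t1 * t3 * θ₁ * θ₁ * θ₂ * θ₂ * θ₃ - t1 * t03 * θ₁ * θ₁ * θ₂ * θ₃ * θ₃ - t1 * t03 * θ₁ * θ₁ *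 θ₂ * θ₂ * θ₃ - t1 * t23 * θ₁ * θ₁ * θ₂ * θ₃ * θ₃ + t1 * t023 * θ₁ * θ₁ * θ₂ * θ₃ * θ₃ + t1 * θ₁ * θ₁ * θ₂ * θ₂ * θ₃ * θ₃ + t2 * t3 * θ₁ * θ₁ * θ₂ * θ₂ * θ₃ - t2 * t03 * θ₁ * θ₂ * θ₂ * θ₃ * θ₃ - t2 * t03 * θ₁ * θ₁ * θ₂ * θ₂ * θ₃ - t2 * t13 * θ₁ * θ₂ * θ₂ * θ₃ * θ₃ + t2 * t013 * θ₁ * θ₂ * θ₂ * θ₃ * θ₃ + t2 * θ₁ * θ₁ * θ₂ * θ₂ * θ₃ * θ₃ - t3 * t12 * θ₁ * θ₂ * θ₂ * θ₃ * θ₃ - t3 * t12 * θ₁ * θ₁ * θ₂ * θ₃ * θ₃ - t3 * t12 * θ₁ * θ₁ * θ₂ * θ₂ * θ₃ + 2 * t3 * θ₁ * θ₁ * θ₂ * θ₂ * θ₃ * θ₃ + t03 * t12 * θ₁ * θ₁ * θ₂ * θ₂ * θ₃ - t03 * θ₁ * θ₁ * θ₂ * θ₂ * θ₃ * θ₃ -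 t12 * θ₁ * θ₁ * θ₂ * θ₂ * θ₃ * θ₃ + θ₁ * θ₁ * θ₂ * θ₂ * θ₃ * θ₃ * θ₃ + t1 * t2 * t3 * θ₁ * θ₂ * θ₂ * θ₃ * θ₃ + t1 * t2 * t3 * θ₁ * θ₁ * θ₂ * θ₃ * θ₃ - 2 * t1 * t3 * θ₁ * θ₁ * θ₂ * θ₂ * θ₃ * θ₃ + t1 * t03 * θ₁ * θ₁ * θ₂ * θ₂ * θ₃ * θ₃ - t1 * θ₁ * θ₁ * θ₂ * θ₂ * θ₃ * θ₃ * θ₃ - 2 * t2 * t3 * θ₁ * θ₁ * θ₂ * θ₂ * θ₃ * θ₃ + t2 * t03 * θ₁ * θ₁ * θ₂ * θ₂ * θ₃ * θ₃ - t2 * θ₁ * θ₁ * θ₂ * θ₂ * θ₃ * θ₃ * θ₃ + t3 * t12 * θ₁ * θ₁ * θ₂ * θ₂ * θ₃ * θ₃ - t3 * θ₁ * θ₁ * θ₂ * θ₂ * θ₃ * θ₃ * θ₃ + t1 * t2 * t3 * θ₁ * θ₁ * θ₂ * θ₂ * θ₃ * θ₃ - t1 * t2 * t03 * θ₁ * θ₁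 * θ₂ * θ₂ * θ₃ * θ₃ + t1 * t2 * θ₁ * θ₁ * θ₂ * θ₂ * θ₃ * θ₃ * θ₃ + t1 * t3 * θ₁ * θ₁ * θ₂ * θ₂ * θ₃ * θ₃ * θ₃ + t2 * t3 * θ₁ * θ₁ * θ₂ * θ₂ * θ₃ * θ₃ * θ₃ - t1 * t2 * t3 * θ₁ * θ₁ * θ₂ * θ₂ * θ₃ * θ₃ * θ₃ := by
  have h := e3prod03_orThreeCoinT3_nonneg _ θ₁ θ₂ θ₃ hT h10 h11 h20 h21 h30 h31
  exact h

set_option maxHeartbeats 4000000 in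
set_option maxRecDepth 100000 in
/-- **`E₃(u_0u_3, u_1, u_2) ≥ 0` for the OR with the independent three-coin block `b = (c₁c₂, c₁c₃, c₂c₃, c₁c₂c₃)`** (measure level). [this work] -/
theorem sahiE_three_prodRow03_orThreeCoinT3_nonneg (μ : γ → ℝ) (ν : β → ℝ)
    (hμ0 : ∀ t, 0 ≤ μ t) (hμ1 : ∑ t, μ t = 1) (hν0 : ∀ t, 0 ≤ ν t) (hν1 : ∑ t, ν t = 1) (hμ2 : SahiPositive μ 2)
    (a : Fin 4 → γ → ℝ) (b : Fin 4 → β → ℝ) (ha0 : ∀ i t, 0 ≤ a i t) (ha1 : ∀ i t, a i t ≤ 1) (ham : ∀ i, Monotone (a i))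
    (c₁ c₂ c₃ : β → ℝ) (hc₁ : ∀ y, c₁ y = 0 ∨ c₁ y = 1) (hc₂ : ∀ y, c₂ y = 0 ∨ c₂ y = 1) (hc₃ : ∀ y, c₃ y = 0 ∨ c₃ y = 1)
    (h12 : ex ν (c₁ * c₂) = ex ν c₁ * ex ν c₂) (h13 : ex ν (c₁ * c₃) = ex ν c₁ * ex ν c₃) (h23 : ex ν (c₂ * c₃) = ex ν c₂ * ex ν c₃)
    (h123 : ex ν (c₁ * c₂ * c₃) = ex ν c₁ * ex ν c₂ * ex ν c₃)
    (hb0 : b 0 = c₁ * c₂) (hb1 : b 1 = c₁ * c₃) (hb2 : b 2 = c₂ * c₃) (hb3 : b 3 = c₁ * c₂ * c₃) (h : H4Plus μ a) :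
    0 ≤ sahiE (fun p : γ × β => μ p.1 * ν p.2) 3 ![(fun (i : Fin 4) (p : γ × β) => a i p.1 + b i p.2 - a i p.1 * b i p.2) 0 * (fun (i : Fin 4) (p : γ × β) => a i p.1 + b i p.2 - a i p.1 * b i p.2) 3, (fun (i : Fin 4) (p : γ × β) => a i p.1 + b i p.2 - a i p.1 * b i p.2) 1, (fun (i : Fin 4) (p : γ × β) => a i p.1 + b i p.2 - a i p.1 * b i p.2) 2] := by
  have hT := aAdmissible_of_h4Plus μ hμ0 hμ1 hμ2 a ha0 ha1 ham h
  have h10 : 0 ≤ ex ν c₁ := ex_nonneg hν0 (fun y => by rcases hc₁ y with e | e <;> simp [e])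
  have h11 : ex ν c₁ ≤ 1 := by
    have t := ex_mono hν0 (fun y => show c₁ y ≤ (fun _ => (1:ℝ)) y by rcases hc₁ y with e | e <;> simp [e]); rw [ex_const hν1] at t; exact t
  have h20 : 0 ≤ ex ν c₂ := ex_nonneg hν0 (fun y => by rcases hc₂ y with e | e <;> simp [e])
  have h21 : ex ν c₂ ≤ 1 := by
    have t := ex_mono hν0 (fun y => show c₂ y ≤ (fun _ => (1:ℝ)) y by rcases hc₂ y with e | e <;> simp [e]); rw [ex_const hν1] at t; exact t
  have h30 : 0 ≤ ex ν c₃ := ex_nonneg hν0 (fun y => by rcases hc₃ y with e | e <;> simp [e])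
  have h31 : ex ν c₃ ≤ 1 := by
    have t := ex_mono hν0 (fun y => show c₃ y ≤ (fun _ => (1:ℝ)) y by rcases hc₃ y with e | e <;> simp [e]); rw [ex_const hν1] at t; exact t
  have mb0 : ex ν (b 0) = ex ν c₁ * ex ν c₂ := by
    have e : (b 0 : β → ℝ) = c₁ * c₂ := by
      funext y; rcases hc₁ y with h1 | h1 <;> rcases hc₂ y with h2 | h2 <;> simp [hb0, h1, h2]
    rw [e, h12]
  have mb1 : ex ν (b 1) = ex ν c₁ * ex ν c₃ := by
    have e : (b 1 : β → ℝ) = c₁ * c₃ := by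
      funext y; rcases hc₁ y with h1 | h1 <;> rcases hc₃ y with h3 | h3 <;> simp [hb1, h1, h3]
    rw [e, h13]
  have mb2 : ex ν (b 2) = ex ν c₂ * ex ν c₃ := by
    have e : (b 2 : β → ℝ) = c₂ * c₃ := by
      funext y; rcases hc₂ y with h2 | h2 <;> rcases hc₃ y with h3 | h3 <;> simp [hb2, h2, h3]
    rw [e, h23]
  have mb3 : ex ν (b 3) = ex ν c₁ * ex ν c₂ * ex ν c₃ := by
    have e : (b 3 : β → ℝ) = c₁ * c₂ * c₃ := by
      funext y; rcases hc₁ y with h1 | h1 <;> rcases hc₂ y with h2 | h2 <;> rcases hc₃ y with h3 | h3 <;> simp [hb3, h1, h2, h3]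
    rw [e, h123]
  have mb01 : ex ν (b 0 * b 1) = ex ν c₁ * ex ν c₂ * ex ν c₃ := by
    have e : (b 0 * b 1 : β → ℝ) = c₁ * c₂ * c₃ := by
      funext y; rcases hc₁ y with h1 | h1 <;> rcases hc₂ y with h2 | h2 <;> rcases hc₃ y with h3 | h3 <;> simp [hb0, hb1, h1, h2, h3]
    rw [e, h123]
  have mb02 : ex ν (b 0 * b 2) = ex ν c₁ * ex ν c₂ * ex ν c₃ := by
    have e : (b 0 * b 2 : β → ℝ) = c₁ * c₂ * c₃ := by
      funext y; rcases hc₁ y with h1 | h1 <;> rcases hc₂ y with h2 | h2 <;> rcases hc₃ y with h3 | h3 <;> simp [hb0, hb2, h1, h2, h3]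
    rw [e, h123]
  have mb03 : ex ν (b 0 * b 3) = ex ν c₁ * ex ν c₂ * ex ν c₃ := by
    have e : (b 0 * b 3 : β → ℝ) = c₁ * c₂ * c₃ := by
      funext y; rcases hc₁ y with h1 | h1 <;> rcases hc₂ y with h2 | h2 <;> rcases hc₃ y with h3 | h3 <;> simp [hb0, hb3, h1, h2, h3]
    rw [e, h123]
  have mb12 : ex ν (b 1 * b 2) = ex ν c₁ * ex ν c₂ * ex ν c₃ := by
    have e : (b 1 * b 2 : β → ℝ) = c₁ * c₂ * c₃ := by
      funext y; rcases hc₁ y with h1 | h1 <;> rcases hc₂ y with h2 | h2 <;> rcases hc₃ y with h3 | h3 <;> simp [hb1, hb2, h1, h2, h3]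
    rw [e, h123]
  have mb13 : ex ν (b 1 * b 3) = ex ν c₁ * ex ν c₂ * ex ν c₃ := by
    have e : (b 1 * b 3 : β → ℝ) = c₁ * c₂ * c₃ := by
      funext y; rcases hc₁ y with h1 | h1 <;> rcases hc₂ y with h2 | h2 <;> rcases hc₃ y with h3 | h3 <;> simp [hb1, hb3, h1, h2, h3]
    rw [e, h123]
  have mb23 : ex ν (b 2 * b 3) = ex ν c₁ * ex ν c₂ * ex ν c₃ := by
    have e : (b 2 * b 3 : β → ℝ) = c₁ * c₂ * c₃ := by
      funext y; rcases hc₁ y with h1 | h1 <;> rcases hc₂ y with h2 | h2 <;> rcases hc₃ y with h3 | h3 <;> simp [hb2, hb3, h1, h2, h3]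
    rw [e, h123]
  have mb012 : ex ν (b 0 * b 1 * b 2) = ex ν c₁ * ex ν c₂ * ex ν c₃ := by
    have e : (b 0 * b 1 * b 2 : β → ℝ) = c₁ * c₂ * c₃ := by
      funext y; rcases hc₁ y with h1 | h1 <;> rcases hc₂ y with h2 | h2 <;> rcases hc₃ y with h3 | h3 <;> simp [hb0, hb1, hb2, h1, h2, h3]
    rw [e, h123]
  have mb013 : ex ν (b 0 * b 1 * b 3) = ex ν c₁ * ex ν c₂ * ex ν c₃ := by
    have e : (b 0 * b 1 * b 3 : β → ℝ) = c₁ * c₂ * c₃ := by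
      funext y; rcases hc₁ y with h1 | h1 <;> rcases hc₂ y with h2 | h2 <;> rcases hc₃ y with h3 | h3 <;> simp [hb0, hb1, hb3, h1, h2, h3]
    rw [e, h123]
  have mb023 : ex ν (b 0 * b 2 * b 3) = ex ν c₁ * ex ν c₂ * ex ν c₃ := by
    have e : (b 0 * b 2 * b 3 : β → ℝ) = c₁ * c₂ * c₃ := by
      funext y; rcases hc₁ y with h1 | h1 <;> rcases hc₂ y with h2 | h2 <;> rcases hc₃ y with h3 | h3 <;> simp [hb0, hb2, hb3, h1, h2, h3]
    rw [e, h123]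
  have mb123 : ex ν (b 1 * b 2 * b 3) = ex ν c₁ * ex ν c₂ * ex ν c₃ := by
    have e : (b 1 * b 2 * b 3 : β → ℝ) = c₁ * c₂ * c₃ := by
      funext y; rcases hc₁ y with h1 | h1 <;> rcases hc₂ y with h2 | h2 <;> rcases hc₃ y with h3 | h3 <;> simp [hb1, hb2, hb3, h1, h2, h3]
    rw [e, h123]
  have mb0123 : ex ν (b 0 * b 1 * b 2 * b 3) = ex ν c₁ * ex ν c₂ * ex ν c₃ := by
    have e : (b 0 * b 1 * b 2 * b 3 : β → ℝ) = c₁ * c₂ * c₃ := by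
      funext y; rcases hc₁ y with h1 | h1 <;> rcases hc₂ y with h2 | h2 <;> rcases hc₃ y with h3 | h3 <;> simp [hb0, hb1, hb2, hb3, h1, h2, h3]
    rw [e, h123]
  have cm0 : (fun (i : Fin 4) (p : γ × β) => a i p.1 + b i p.2 - a i p.1 * b i p.2) 0 * (fun (i : Fin 4) (p : γ × β) => a i p.1 + b i p.2 - a i p.1 * b i p.2) 3 * (fun (i : Fin 4) (p : γ × β) => a i p.1 + b i p.2 - a i p.1 * b i p.2) 1 * (fun (i : Fin 4) (p : γ × β) => a i p.1 + b i p.2 - a i p.1 * b i p.2) 2 = (fun (i : Fin 4) (p : γ × β) => a i p.1 + b i p.2 - a i p.1 * b i p.2) 0 * (fun (i : Fin 4) (p : γ × β) => a i p.1 + b i p.2 - a i p.1 * b i p.2) 1 * (fun (i : Fin 4) (p : γ × β) => a i p.1 + b i p.2 - a i p.1 * b i p.2) 2 * (fun (i : Fin 4) (p : γ × β) => a i p.1 + b i p.2 - a i p.1 * b i p.2) 3 := by funext p; simp only [Pi.mul_apply]; ring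
  have cm1 : (fun (i : Fin 4) (p : γ × β) => a i p.1 + b i p.2 - a i p.1 * b i p.2) 0 * (fun (i : Fin 4) (p : γ × β) => a i p.1 + b i p.2 - a i p.1 * b i p.2) 3 * (fun (i : Fin 4) (p : γ × β) => a i p.1 + b i p.2 - a i p.1 * b i p.2) 2 = (fun (i : Fin 4) (p : γ × β) => a i p.1 + b i p.2 - a i p.1 * b i p.2) 0 * (fun (i : Fin 4) (p : γ × β) => a i p.1 + b i p.2 - a i p.1 * b i p.2) 2 * (fun (i : Fin 4) (p : γ × β) => a i p.1 + b i p.2 - a i p.1 * b i p.2) 3 := by funext p; simp only [Pi.mul_apply]; ring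
  have cm2 : (fun (i : Fin 4) (p : γ × β) => a i p.1 + b i p.2 - a i p.1 * b i p.2) 0 * (fun (i : Fin 4) (p : γ × β) => a i p.1 + b i p.2 - a i p.1 * b i p.2) 3 * (fun (i : Fin 4) (p : γ × β) => a i p.1 + b i p.2 - a i p.1 * b i p.2) 1 = (fun (i : Fin 4) (p : γ × β) => a i p.1 + b i p.2 - a i p.1 * b i p.2) 0 * (fun (i : Fin 4) (p : γ × β) => a i p.1 + b i p.2 - a i p.1 * b i p.2) 1 * (fun (i : Fin 4) (p : γ × β) => a i p.1 + b i p.2 - a i p.1 * b i p.2) 3 := by funext p; simp only [Pi.mul_apply]; ring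
  rw [sahiE_three, cm0, cm1, cm2, uMoment_0123 μ ν hμ1 hν1 a b, uMoment_023 μ ν hμ1 hν1 a b, uMoment_013 μ ν hμ1 hν1 a b, uMoment_12 μ ν hμ1 hν1 a b, uMoment_03 μ ν hμ1 hν1 a b, uMoment_1 μ ν hμ1 hν1 a b, uMoment_2 μ ν hμ1 hν1 a b]
  rw [exFail_0 μ hμ1 a, exFail_1 μ hμ1 a, exFail_2 μ hμ1 a, exFail_3 μ hμ1 a, exFail_01 μ hμ1 a, exFail_02 μ hμ1 a, exFail_03 μ hμ1 a, exFail_12 μ hμ1 a, exFail_13 μ hμ1 a, exFail_23 μ hμ1 a, exFail_012 μ hμ1 a, exFail_013 μ hμ1 a, exFail_023 μ hμ1 a, exFail_123 μ hμ1 a, exFail_0123 μ hμ1 a]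
  rw [exFail_0 ν hν1 b, exFail_1 ν hν1 b, exFail_2 ν hν1 b, exFail_3 ν hν1 b, exFail_01 ν hν1 b, exFail_02 ν hν1 b, exFail_03 ν hν1 b, exFail_12 ν hν1 b, exFail_13 ν hν1 b, exFail_23 ν hν1 b, exFail_012 ν hν1 b, exFail_013 ν hν1 b, exFail_023 ν hν1 b, exFail_123 ν hν1 b, exFail_0123 ν hν1 b]
  rw [mb0, mb1, mb2, mb3, mb01, mb02, mb03, mb12, mb13, mb23, mb012, mb013, mb023, mb123, mb0123]
  linear_combination e3prod03_orThreeCoinT3_nonneg_explicit (ex μ (a 0)) (ex μ (a 1)) (ex μ (a 2)) (ex μ (a 3)) (ex μ (a 0 * a 1)) (ex μ (a 0 * a 2)) (ex μ (a 0 * a 3)) (ex μ (a 1 * a 2)) (ex μ (a 1 * a 3)) (ex μ (a 2 * a 3)) (ex μ (a 0 * a 1 * a 2)) (ex μ (a 0 * a 1 * a 3)) (ex μ (a 0 * a 2 * a 3)) (ex μ (a 1 * a 2 * a 3)) (ex μ (a 0 * a 1 * a 2 * a 3)) (ex ν c₁) (ex ν c₂) (ex ν c₃) hT h10 h11 h20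 h21 h30 h31

end Summit.CriticalPhenomena.PercolationContinuityZ3.Theorems.SahiE4UnionThreeCoin

end
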